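import Literature.Analysis.Matrix.LogDetDerivative
import Mathlib.MeasureTheory.Integral.IntervalIntegral.FundThmCalculus
import Mathlib.Topology.Instances.Matrix
import HarnessLib

/-!
# The mixed second difference of `log det` over a rectangle of matrices, with LOCALISED variations
# (`Δ_bΔ_{b′} log det M` = resolvent term + mixed-response term; the cluster-expansion bookkeeping behind one-loop clustering)

Topic `Literature/Analysis/Matrix`; namespace `Literature.Analysis.Matrix`.  Sequel of `LogDetDerivative.lean` (Jacobi's formula
`d/ds log det M = tr(M⁻¹ M′)`, `hasDerivAt_real_log_det`).  Everything here is PROVED; no definitions, no named facts.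

THE QUESTION.  Four invertible matrices at the corners of a rectangle — `M(0,0), M(1,0)` (one «bond» `b` varied), `M(0,1), M(1,1)` (a second
bond `b′` varied as well) — and the mixed second difference («connected 4-point»)
`Δ² log det := log det M(0,0) − log det M(1,0) − log det M(0,1) + log det M(1,1)`.  When the `s`-variation `∂ₛM` is supported near `b`, the
`t`-variation `M(s,1) − M(s,0)` near `b′`, the MIXED response `∂ₛM(s,1) − ∂ₛM(s,0)` is small, and the inverses have small entries between the two
supports (exponential decay of `M⁻¹` off the diagonal — Combes–Thomas, `CoerciveCombesThomas.coercive_combes_thomas`), then `Δ² log det` is small: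
this is the matrix-level mechanism of the exponential clustering of one-loop (`−½ log det Hessian`) quantities in cluster expansions
([Balaban1985Variational] (10) p. 279 with [Balaban1984PropagatorsII] (1.33): localised response of the background field and decay of the propagators;
[GlimmJaffe1987, §18] for the generic mechanism).

* §1 `log_det_sub_eq_integral_trace` — FTC: along a C¹ path of invertible real matrices, `log det M(1) − log det M(0) = ∫₀¹ tr(M(s)⁻¹ M′(s)) ds`.
* §2 `trace_inv_mul_sub` — the resolvent identity `tr(M₁⁻¹D) − tr(M₀⁻¹D) = −tr(M₁⁻¹ (M₁ − M₀) M₀⁻¹ D)`.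
* §3 `abs_trace_mul_le_sum`, `abs_trace_mul4_le_sum`, ★`abs_trace_mul4_le_of_blocks` — entrywise bounds: with `E` supported in a block `I′ × I′`, `D` in `I × I`,
  `|A a b′| ≤ α` for `a ∈ I, b′ ∈ I′`, `|B c′ d| ≤ β` for `c′ ∈ I′, d ∈ I` (the CROSS entries of the two inverses — where the decay sits), `|E| ≤ ε`, `|D| ≤ δ`:
  `|tr(A E B D)| ≤ |I|²·|I′|²·α·ε·β·δ`; `abs_trace_mul_le_of_entry_le` — `|tr(B R)| ≤ |n|²·β₀·η`.
* §4 ★★`abs_fourPt_log_det_le` — the rectangle: `|Δ² log det| ≤ |I|²|I′|²·α·ε·β·δ + |n|²·β₀·η` under the displayed rows (C¹ in `s` at `t = 0, 1`; invertible;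
  block supports of `∂ₛM(s,1)` and `M(s,1) − M(s,0)`; cross-entry bounds `α, β` of `M(s,1)⁻¹, M(s,0)⁻¹`; global entry bound `β₀` of `M(s,0)⁻¹`; mixed response
  `|∂ₛM(s,1) − ∂ₛM(s,0)| ≤ η`), uniformly in `s ∈ [0,1]`.

Consumer (cell `ym3-torus`, LINE «semiclassical isolation table for S2β», stub LAPLACE, letter DECAY): the `−½ log det Ah` factor of the one-loop constant;
`α = β = (2∕g)·e^{−θ·dist(I_b, I_{b′})}` from `coercive_combes_thomas` and the stiffness gap.  HONEST SCOPE: finite-dimensional linear algebra and one FTC;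
nothing here bears on the Yang–Mills mass gap (Clay), which is NOT proved.

References: T. Bałaban, CMP 102 (1985) 277, Thm 1 (10) p. 279 [Balaban1985Variational]; CMP 96 (1984) (1.33) [Balaban1984PropagatorsII];
J. Glimm, A. Jaffe, *Quantum Physics* (2nd ed. 1987) §18.2 [GlimmJaffe1987]; R. A. Horn, C. R. Johnson, *Matrix Analysis* (2013) §0.8 [HornJohnson2013].
-/

noncomputable section

open Matrix Finset MeasureTheory intervalIntegral
open scoped Matrix

namespace Literature.Analysis.Matrix

variable {n : Type*} [Fintype n] [DecidableEq n]

/-! ## §1 FTC for `log det` along a C¹ path -/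

/-- **`log det M(1) − log det M(0) = ∫₀¹ tr(M(s)⁻¹ M′(s)) ds`** for an entrywise-C¹ path of real matrices with `det M(s) ≠ 0` — Jacobi's formula
integrated. [cite: HornJohnson2013, §0.8.10 (Jacobi's formula)] -/
theorem log_det_sub_eq_integral_trace {M M' : ℝ → Matrix n n ℝ}
    (hM : ∀ s i j, HasDerivAt (fun s => M s i j) (M' s i j) s) (hM'c : ∀ i j, Continuous fun s => M' s i j)
    (hne : ∀ s, (M s).det ≠ 0) :
    Real.log (M 1).det - Real.log (M 0).det = ∫ s in (0 : ℝ)..1, ((M s)⁻¹ * M' s).trace := by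
  have hMc : Continuous M := continuous_matrix fun i j => continuous_iff_continuousAt.2 fun s => (hM s i j).continuousAt
  have hM'cm : Continuous M' := continuous_matrix hM'c
  have hinv : Continuous fun s => (M s)⁻¹ := by
    refine continuous_iff_continuousAt.2 fun s => ?_
    have h : ContinuousAt Ring.inverse (M s).det := by
      rw [Ring.inverse_eq_inv']
      exact continuousAt_inv₀ (hne s)
    exact ContinuousAt.comp (f := M) (g := fun A : Matrix n n ℝ => A⁻¹) (continuousAt_matrix_inv (M s) h) hMc.continuousAt
  have htr : Continuous fun s => ((M s)⁻¹ * M' s).trace := (hinv.mul hM'cm).matrix_trace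
  rw [integral_eq_sub_of_hasDerivAt (fun s _ => LogDetDerivative.hasDerivAt_real_log_det (hM s) (hne s)) (htr.intervalIntegrable _ _)]

/-! ## §2 The resolvent identity -/

/-- `M₁⁻¹ − M₀⁻¹ = −M₁⁻¹ (M₁ − M₀) M₀⁻¹` for invertible `M₀, M₁` (a local signed form of `DeterminantDefectInequality.inv_sub_inv_eq_mul`).
[cite: HornJohnson2013, §0.7.4] -/
private theorem inv_sub_inv_eq_neg {M₀ M₁ : Matrix n n ℝ} (h₀ : M₀.det ≠ 0) (h₁ : M₁.det ≠ 0) :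
    M₁⁻¹ - M₀⁻¹ = -(M₁⁻¹ * (M₁ - M₀) * M₀⁻¹) := by
  have hu₀ : IsUnit M₀.det := isUnit_iff_ne_zero.2 h₀
  have hu₁ : IsUnit M₁.det := isUnit_iff_ne_zero.2 h₁
  rw [Matrix.mul_sub, Matrix.sub_mul, Matrix.nonsing_inv_mul _ hu₁, Matrix.one_mul, Matrix.mul_assoc, Matrix.mul_nonsing_inv _ hu₀,
    Matrix.mul_one]
  abel

/-- **`tr(M₁⁻¹ D) − tr(M₀⁻¹ D) = −tr(M₁⁻¹ (M₁ − M₀) M₀⁻¹ D)`**. [cite: HornJohnson2013, §0.7.4] -/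
theorem trace_inv_mul_sub {M₀ M₁ : Matrix n n ℝ} (h₀ : M₀.det ≠ 0) (h₁ : M₁.det ≠ 0) (D : Matrix n n ℝ) :
    (M₁⁻¹ * D).trace - (M₀⁻¹ * D).trace = -(M₁⁻¹ * (M₁ - M₀) * M₀⁻¹ * D).trace := by
  rw [← Matrix.trace_sub, ← Matrix.sub_mul, inv_sub_inv_eq_neg h₀ h₁, Matrix.neg_mul, Matrix.trace_neg]

/-! ## §3 Entrywise bounds for traces of products -/

omit [DecidableEq n] in
/-- `|tr(B R)| ≤ Σ_{a,b} |B a b|·|R b a|`. [cite: HornJohnson2013, §5.6 (entrywise estimates)] -/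
theorem abs_trace_mul_le_sum (B R : Matrix n n ℝ) : |(B * R).trace| ≤ ∑ a, ∑ b, |B a b| * |R b a| := by
  rw [Matrix.trace]
  refine (Finset.abs_sum_le_sum_abs _ _).trans (Finset.sum_le_sum fun a _ => ?_)
  rw [Matrix.diag_apply, Matrix.mul_apply]
  refine (Finset.abs_sum_le_sum_abs _ _).trans (Finset.sum_le_sum fun b _ => ?_)
  rw [abs_mul]

omit [DecidableEq n] in
/-- With global entry bounds `|B| ≤ β₀`, `|R| ≤ η`: `|tr(B R)| ≤ |n|²·β₀·η`. [cite: HornJohnson2013, §5.6] -/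
theorem abs_trace_mul_le_of_entry_le {B R : Matrix n n ℝ} {β₀ η : ℝ} (hβ₀ : 0 ≤ β₀) (hB : ∀ a b, |B a b| ≤ β₀) (hR : ∀ a b, |R a b| ≤ η) :
    |(B * R).trace| ≤ (Fintype.card n : ℝ) ^ 2 * β₀ * η := by
  refine (abs_trace_mul_le_sum B R).trans ?_
  calc ∑ a, ∑ b, |B a b| * |R b a| ≤ ∑ _a : n, ∑ _b : n, β₀ * η :=
        Finset.sum_le_sum fun a _ => Finset.sum_le_sum fun b _ => mul_le_mul (hB a b) (hR b a) (abs_nonneg _) hβ₀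
    _ = (Fintype.card n : ℝ) ^ 2 * β₀ * η := by
        simp only [Finset.sum_const, Finset.card_univ, nsmul_eq_mul]
        ring

omit [DecidableEq n] in
/-- `|tr(A E B D)| ≤ Σ_{a,b,c,d} |A a b|·|E b c|·|B c d|·|D d a|`. [cite: HornJohnson2013, §5.6] -/
theorem abs_trace_mul4_le_sum (A E B D : Matrix n n ℝ) :
    |(A * E * B * D).trace| ≤ ∑ a, ∑ b, ∑ c, ∑ d, |A a b| * |E b c| * |B c d| * |D d a| := by
  rw [Matrix.trace]
  refine (Finset.abs_sum_le_sum_abs _ _).trans (Finset.sum_le_sum fun a _ => ?_)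
  rw [Matrix.diag_apply, Matrix.mul_apply]
  refine (Finset.abs_sum_le_sum_abs _ _).trans ?_
  -- `((A E B) D)_{aa} = Σ_d (A E B)_{a d} D_{d a}`, `(A E B)_{a d} = Σ_c (A E)_{a c} B_{c d}`, `(A E)_{a c} = Σ_b A_{a b} E_{b c}`
  have h1 : ∀ d, |(A * E * B) a d * D d a| ≤ ∑ b, ∑ c, |A a b| * |E b c| * |B c d| * |D d a| := by
    intro d
    rw [abs_mul, Matrix.mul_apply]
    calc |∑ c, (A * E) a c * B c d| * |D d a| ≤ (∑ c, |(A * E) a c * B c d|) * |D d a| :=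
          mul_le_mul_of_nonneg_right (Finset.abs_sum_le_sum_abs _ _) (abs_nonneg _)
      _ = ∑ c, |(A * E) a c| * |B c d| * |D d a| := by rw [Finset.sum_mul]; simp only [abs_mul]
      _ ≤ ∑ c, (∑ b, |A a b| * |E b c|) * |B c d| * |D d a| := by
          refine Finset.sum_le_sum fun c _ => ?_
          refine mul_le_mul_of_nonneg_right (mul_le_mul_of_nonneg_right ?_ (abs_nonneg _)) (abs_nonneg _)
          rw [Matrix.mul_apply]
          exact (Finset.abs_sum_le_sum_abs _ _).trans (le_of_eq (Finset.sum_congr rfl fun b _ => abs_mul _ _))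
      _ = ∑ b, ∑ c, |A a b| * |E b c| * |B c d| * |D d a| := by
          rw [Finset.sum_comm]
          refine Finset.sum_congr rfl fun c _ => ?_
          rw [Finset.sum_mul, Finset.sum_mul]
  calc ∑ d, |(A * E * B) a d * D d a| ≤ ∑ d, ∑ b, ∑ c, |A a b| * |E b c| * |B c d| * |D d a| := Finset.sum_le_sum fun d _ => h1 d
    _ = ∑ b, ∑ c, ∑ d, |A a b| * |E b c| * |B c d| * |D d a| := by
        rw [Finset.sum_comm]
        exact Finset.sum_congr rfl fun b _ => Finset.sum_comm

/-- ★ **THE LOCALISED 4-FACTOR TRACE BOUND.**  `E` supported in the block `I′ × I′`, `D` in `I × I`, `|E| ≤ ε`, `|D| ≤ δ`; the CROSS entries of the two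
outer factors are small: `|A a b′| ≤ α` (`a ∈ I`, `b′ ∈ I′`) and `|B c′ d| ≤ β` (`c′ ∈ I′`, `d ∈ I`) — for inverses of gapped finite-range matrices
`α, β = (2∕g)·e^{−θ·dist(I,I′)}` by Combes–Thomas.  Then `|tr(A E B D)| ≤ |I|²·|I′|²·α·ε·β·δ`. [cite: HornJohnson2013, §5.6]
[cite: GlimmJaffe1987, §18.2 (cluster expansion bookkeeping)] -/
theorem abs_trace_mul4_le_of_blocks {A E B D : Matrix n n ℝ} {I I' : Finset n} {α ε β δ : ℝ}
    (hα : 0 ≤ α) (hε : 0 ≤ ε) (hβ : 0 ≤ β) (hδ : 0 ≤ δ)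
    (hE0 : ∀ b c, (b ∉ I' ∨ c ∉ I') → E b c = 0) (hEb : ∀ b c, |E b c| ≤ ε)
    (hD0 : ∀ d a, (d ∉ I ∨ a ∉ I) → D d a = 0) (hDb : ∀ d a, |D d a| ≤ δ)
    (hA : ∀ a ∈ I, ∀ b ∈ I', |A a b| ≤ α) (hB : ∀ c ∈ I', ∀ d ∈ I, |B c d| ≤ β) :
    |(A * E * B * D).trace| ≤ (I.card : ℝ) ^ 2 * (I'.card : ℝ) ^ 2 * α * ε * β * δ := by
  classical
  refine (abs_trace_mul4_le_sum A E B D).trans ?_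
  -- each summand is `≤ α ε β δ` on `I × I′ × I′ × I` and `0` elsewhere
  have hterm : ∀ a b c d, |A a b| * |E b c| * |B c d| * |D d a| ≤
      (if a ∈ I then 1 else 0) * (if b ∈ I' then 1 else 0) * (if c ∈ I' then 1 else 0) * (if d ∈ I then 1 else 0) * (α * ε * β * δ) := by
    intro a b c d
    by_cases ha : a ∈ I
    · by_cases hb : b ∈ I'
      · by_cases hc : c ∈ I'
        · by_cases hd : d ∈ I
          · simp only [ha, hb, hc, hd, if_true, one_mul]
            have h1 := hA a ha b hb
            have h2 := hEb b c
            have h3 := hB c hc d hd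
            have h4 := hDb d a
            calc |A a b| * |E b c| * |B c d| * |D d a| ≤ α * ε * β * δ := by gcongr
              _ = α * ε * β * δ := rfl
          · rw [hD0 d a (Or.inl hd), abs_zero, mul_zero]
            positivity
        · rw [hE0 b c (Or.inr hc), abs_zero, mul_zero, zero_mul, zero_mul]
          positivity
      · rw [hE0 b c (Or.inl hb), abs_zero, mul_zero, zero_mul, zero_mul]
        positivity
    · rw [hD0 d a (Or.inr ha), abs_zero, mul_zero]
      positivity
  calc ∑ a, ∑ b, ∑ c, ∑ d, |A a b| * |E b c| * |B c d| * |D d a|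
      ≤ ∑ a, ∑ b, ∑ c, ∑ d, (if a ∈ I then 1 else 0) * (if b ∈ I' then 1 else 0) * (if c ∈ I' then 1 else 0) *
          (if d ∈ I then 1 else 0) * (α * ε * β * δ) :=
        Finset.sum_le_sum fun a _ => Finset.sum_le_sum fun b _ => Finset.sum_le_sum fun c _ => Finset.sum_le_sum fun d _ => hterm a b c d
    _ = (I.card : ℝ) ^ 2 * (I'.card : ℝ) ^ 2 * α * ε * β * δ := by
        have hI : ∑ x : n, (if x ∈ I then (1 : ℝ) else 0) = I.card := by
          rw [Finset.sum_ite_mem, Finset.univ_inter, Finset.sum_const, nsmul_eq_mul, mul_one]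
        have hI' : ∑ x : n, (if x ∈ I' then (1 : ℝ) else 0) = I'.card := by
          rw [Finset.sum_ite_mem, Finset.univ_inter, Finset.sum_const, nsmul_eq_mul, mul_one]
        simp only [← Finset.sum_mul, ← Finset.mul_sum]
        rw [hI, hI']
        ring

/-! ## §4 The rectangle: `Δ² log det` with localised variations -/

/-- The pointwise decomposition of the `t`-difference of Jacobi's integrand: resolvent term + mixed-response term.
`tr(M₁⁻¹ M′₁) − tr(M₀⁻¹ M′₀) = −tr(M₁⁻¹ (M₁ − M₀) M₀⁻¹ M′₁) + tr(M₀⁻¹ (M′₁ − M′₀))`. [cite: HornJohnson2013, §0.7.4] -/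
theorem trace_inv_mul_sub_trace_inv_mul {M₀ M₁ D₀ D₁ : Matrix n n ℝ} (h₀ : M₀.det ≠ 0) (h₁ : M₁.det ≠ 0) :
    (M₁⁻¹ * D₁).trace - (M₀⁻¹ * D₀).trace = -(M₁⁻¹ * (M₁ - M₀) * M₀⁻¹ * D₁).trace + (M₀⁻¹ * (D₁ - D₀)).trace := by
  rw [← trace_inv_mul_sub h₀ h₁ D₁, Matrix.mul_sub, Matrix.trace_sub]
  ring

/-- ★★ **THE MIXED SECOND DIFFERENCE OF `log det` OVER A RECTANGLE WITH LOCALISED VARIATIONS.**  A two-parameter family `M(s,t)` of invertible real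
matrices, entrywise C¹ in `s` (derivative `M′(s,t)`, continuous in `s`) at `t = 0` and `t = 1`; the `s`-variation at `t = 1` supported in the block `I × I` with
entries `≤ δ`; the `t`-variation `M(s,1) − M(s,0)` supported in `I′ × I′` with entries `≤ ε`; CROSS entries of the inverses `|M(s,1)⁻¹ a b′| ≤ α` (`a ∈ I`,
`b′ ∈ I′`), `|M(s,0)⁻¹ c′ d| ≤ β` (`c′ ∈ I′`, `d ∈ I`); global entries `|M(s,0)⁻¹| ≤ β₀`; MIXED RESPONSE `|M′(s,1) − M′(s,0)| ≤ η`.  Then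
`|log det M(0,0) − log det M(1,0) − (log det M(0,1) − log det M(1,1))| ≤ |I|²·|I′|²·α·ε·β·δ + |n|²·β₀·η`.  (For inverses of gapped finite-range matrices
`α = β = (2∕g)·e^{−θ·dist(I,I′)}` — `CoerciveCombesThomas.coercive_combes_thomas` — and `η` is the localised mixed response of the family: exponential
clustering of the one-loop `log det`.) [cite: Balaban1985Variational, Thm 1 (10) p. 279] [cite: GlimmJaffe1987, §18.2] [cite: HornJohnson2013, §0.8.10] -/
theorem abs_fourPt_log_det_le {M M' : ℝ → ℝ → Matrix n n ℝ}
    (hM : ∀ t s i j, HasDerivAt (fun s => M s t i j) (M' s t i j) s) (hM'c : ∀ t i j, Continuous fun s => M' s t i j)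
    (hne : ∀ s t, (M s t).det ≠ 0)
    {I I' : Finset n} {α ε β δ β₀ η : ℝ} (hα : 0 ≤ α) (hε : 0 ≤ ε) (hβ : 0 ≤ β) (hδ : 0 ≤ δ) (hβ₀ : 0 ≤ β₀)
    (hD0 : ∀ s d a, (d ∉ I ∨ a ∉ I) → M' s 1 d a = 0) (hDb : ∀ s d a, |M' s 1 d a| ≤ δ)
    (hE0 : ∀ s b c, (b ∉ I' ∨ c ∉ I') → (M s 1 - M s 0) b c = 0) (hEb : ∀ s b c, |(M s 1 - M s 0) b c| ≤ ε)
    (hA : ∀ s, ∀ a ∈ I, ∀ b ∈ I', |(M s 1)⁻¹ a b| ≤ α) (hB : ∀ s, ∀ c ∈ I', ∀ d ∈ I, |(M s 0)⁻¹ c d| ≤ β)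
    (hB0 : ∀ s a b, |(M s 0)⁻¹ a b| ≤ β₀) (hR : ∀ s a b, |(M' s 1 - M' s 0) a b| ≤ η) :
    |Real.log (M 0 0).det - Real.log (M 1 0).det - (Real.log (M 0 1).det - Real.log (M 1 1).det)|
      ≤ (I.card : ℝ) ^ 2 * (I'.card : ℝ) ^ 2 * α * ε * β * δ + (Fintype.card n : ℝ) ^ 2 * β₀ * η := by
  -- Jacobi integrated along `s` at `t = 1` and `t = 0`
  have h1 := log_det_sub_eq_integral_trace (M := fun s => M s 1) (M' := fun s => M' s 1) (hM 1) (hM'c 1) (fun s => hne s 1)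
  have h0 := log_det_sub_eq_integral_trace (M := fun s => M s 0) (M' := fun s => M' s 0) (hM 0) (hM'c 0) (fun s => hne s 0)
  -- continuity of the two integrands (for integrability)
  have hcont : ∀ t, Continuous fun s => ((M s t)⁻¹ * M' s t).trace := by
    intro t
    have hMc : Continuous fun s => M s t :=
      continuous_matrix fun i j => continuous_iff_continuousAt.2 fun s => (hM t s i j).continuousAt
    have hinv : Continuous fun s => (M s t)⁻¹ := by
      refine continuous_iff_continuousAt.2 fun s => ?_
      have h : ContinuousAt Ring.inverse (M s t).det := by
        rw [Ring.inverse_eq_inv']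
        exact continuousAt_inv₀ (hne s t)
      exact ContinuousAt.comp (f := fun s => M s t) (g := fun A : Matrix n n ℝ => A⁻¹) (continuousAt_matrix_inv (M s t) h) hMc.continuousAt
    exact (hinv.mul (continuous_matrix (hM'c t))).matrix_trace
  have hrw : Real.log (M 0 0).det - Real.log (M 1 0).det - (Real.log (M 0 1).det - Real.log (M 1 1).det) =
      ∫ s in (0 : ℝ)..1, (((M s 1)⁻¹ * M' s 1).trace - ((M s 0)⁻¹ * M' s 0).trace) := by
    rw [intervalIntegral.integral_sub ((hcont 1).intervalIntegrable _ _) ((hcont 0).intervalIntegrable _ _)]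
    beta_reduce at h1 h0
    linarith
  rw [hrw]
  -- pointwise bound of the integrand
  have hpt : ∀ s, |((M s 1)⁻¹ * M' s 1).trace - ((M s 0)⁻¹ * M' s 0).trace| ≤
      (I.card : ℝ) ^ 2 * (I'.card : ℝ) ^ 2 * α * ε * β * δ + (Fintype.card n : ℝ) ^ 2 * β₀ * η := by
    intro s
    rw [trace_inv_mul_sub_trace_inv_mul (hne s 0) (hne s 1)]
    refine (abs_add_le _ _).trans (add_le_add ?_ ?_)
    · rw [abs_neg]
      exact abs_trace_mul4_le_of_blocks hα hε hβ hδ (hE0 s) (hEb s) (hD0 s) (hDb s) (hA s) (hB s)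
    · exact abs_trace_mul_le_of_entry_le hβ₀ (hB0 s) (hR s)
  have hbd := intervalIntegral.norm_integral_le_of_norm_le_const (a := (0 : ℝ)) (b := 1)
    (f := fun s => ((M s 1)⁻¹ * M' s 1).trace - ((M s 0)⁻¹ * M' s 0).trace)
    (C := (I.card : ℝ) ^ 2 * (I'.card : ℝ) ^ 2 * α * ε * β * δ + (Fintype.card n : ℝ) ^ 2 * β₀ * η)
    (fun s _ => by rw [Real.norm_eq_abs]; exact hpt s)
  rw [Real.norm_eq_abs, sub_zero, abs_one, mul_one] at hbd
  exact hbd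

end Literature.Analysis.Matrix

end
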